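import Mathlib
import Literature.NumberTheory.LFunctions.Zhang2022.Section17Eq177Head
import Literature.NumberTheory.LFunctions.Zhang2022.Section17Eq177Tail
import Literature.NumberTheory.LFunctions.Zhang2022.Section17Eq177ExtWeight
import Literature.NumberTheory.LFunctions.Zhang2022.Section17Eq177
import HarnessLib

/-!
# Zhang (2022) §17 (17.7): the `Ψ₁ → Ψ` extension on `𝔍(−1)` assembled, and the node `Eq17_7` BY NAME

Topic `Literature/NumberTheory/LFunctions/Zhang2022` (Landau–Siegel audit tree; verdict-neutral).
Y. Zhang, *Discrete mean estimates and the Landau–Siegel zero*, arXiv:2211.02515v1 (2022)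
[Zhang2022LandauSiegel] — **an unrefereed manuscript under adjudication**; nothing here asserts or
denies its Theorems 1–2. DAG node `Z22:(17.7)` [Z22 p.97, (17.7), tex L4785]: "Moving the segment
`𝔍(−α)` to `𝔍(−1)` and then extend the sum over `Ψ₁` to the sum over `Ψ` we obtain
`Σ_{ψ∈Ψ₁}(p_ψt₀)^{β₃}I₄⁻(ψ) = Σ_{p∼P}(pt₀)^{β₂}Φ₃⁻(p) + o(𝔓)`." The EXTENSION clause, which §17 does
not prove, is the (7.3)→(7.5) method (§7 p.35): per character the integrand `𝔨₃*(s,ψ)ω(s)` on `𝔍(−1)`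
splits into an exponentially small TAIL (the `ϱ*_≤`-series beyond `⌊P²⌋`, moved to `𝔍(−𝓛⁹)`; tree
`Eq177.sum_PsiTwo_norm_segInt_kfrak3Star_sub_head_le`, zl-w14-p4) and an entire HEAD (moved to `𝔍(0)`,
then Hölder with Lemma 3.3 (ii) and Proposition 2.1; tree `Eq177.sum_PsiTwo_norm_segInt_head_le`,
zl-w16-p7). This file is the composition of record (zl-w16-p7's ROUTE+CUT 01:34Z; W16-S5c (a)):

* `norm_sum_PsiTwo_kfrak3Star_le` — **the unweighted extension error**: for every `ε > 0`, all large
  `D`, under (A), `Σ_{ψ∈Ψ₂}‖(1/2πi)∫_{𝔍(−1)}𝔨₃*(s,ψ)ω(s)ds‖ ≤ ε𝔓` (tail `ε/2` + head `ε/2`);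
* `norm_sum_PsiTwo_weighted_kfrak3Star_le` — the `hext` hypothesis of the (17.7) assembly VERBATIM
  (`|(p_ψt₀)^{β₂}| = 1`, zl-w14-p2's `norm_sum_PsiTwo_weighted_kfrak3Star_le_of`);
* `eq17_7_of_prop22` — **`0 ≤ c′ → Prop22 c′ → Typed.Section17.Eq17_7 c′`** (zl-w16-p7's
  `eq17_7_of_ext`); `eq17_7_eventually` — `∃ c₀ ≥ 0, ∀ c′ ≥ c₀, Eq17_7 c′` (`eq17_7_eventually_of_ext`,
  Prop. 2.2 for large `c′` being the tree's `prop22_eventually`); `eq17_7_holds_of_le` — the same in the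
  skeleton's `∀ c′ ≥ c₀` binder shape.

So the node `Typed.Section17.Eq17_7 c′` — the `h7` input of `Phi3Eval.eq17_9RelE_of_chiNodes` /
`eq17_9RelD_of_appB_legs` under the leaf `h17_9` — is a theorem for every sufficiently large `c′`, with NO
hypothesis. Theorems only; no definitions, no named facts; axioms standard. ZHANG-L discharge lane (WP16,
seat zl-w14-p1 g2 = composer of record / (H)-successor; pieces by zl-w16-p7 (u011, move, head, assembly),
zl-w14-p4 g2 (tail), zl-w14-p2 (weight)). WHAT THIS IS NOT: (17.9), the leaf `Eq17_9RelE`, or any claim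
about Theorems 1–2 of the source or about Landau–Siegel zeros.

## References

* Y. Zhang, arXiv:2211.02515v1 (2022), §17 (17.7) p.97, tex L4770–L4790; §7 (7.3)–(7.5) pp.34–35.
  [cite: Zhang2022LandauSiegel, §17 (17.7) p.97]
-/

noncomputable section

open Complex Real Finset ComplexConjugate
open Literature.NumberTheory.LFunctions.Zhang2022.Skeleton
open Literature.NumberTheory.LFunctions.Zhang2022.Typed.Section17

namespace Literature.NumberTheory.LFunctions.Zhang2022.Eq177

/-- **The `Ψ₂`-extension error of (17.7), unweighted**: for every `c′` and `ε > 0`, for all large `D`,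
under (A), `Σ_{ψ∈Ψ₂}‖(1/2πi)∫_{𝔍(−1)}𝔨₃*(s,ψ)ω(s)ds‖ ≤ ε𝔓` — triangle inequality per character between
the full integral and the head integral (`Σ‖I‖ ≤ Σ‖I − H‖ + Σ‖H‖`), the tail half at `ε/2`
(`sum_PsiTwo_norm_segInt_kfrak3Star_sub_head_le`, zl-w14-p4) and the head half at `ε/2`
(`sum_PsiTwo_norm_segInt_head_le`, zl-w16-p7). [cite: Zhang2022LandauSiegel, §17 (17.7) p.97; §7 (7.5) p.35] -/
theorem norm_sum_PsiTwo_kfrak3Star_le (c' : ℝ) :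
    ∀ ε : ℝ, 0 < ε → ForAllLarge fun D _ χ => AssumptionA D χ →
      ∑ x ∈ finsetOf (PsiTwo χ),
          ‖Lemma81.segInt (t0 D) (ell1 D) (-1) (fun s => kfrak3Star c' χ x s * omegaW D s)‖ ≤
        ε * frakP D := by
  intro ε hε
  have hε2 : 0 < ε / 2 := by positivity
  have hT := sum_PsiTwo_norm_segInt_kfrak3Star_sub_head_le c' (ε / 2) hε2
  have hH := sum_PsiTwo_norm_segInt_head_le c' (ε / 2) hε2
  refine (hT.and hH).mono ?_
  intro D _ χ hq hp h hA
  obtain ⟨hTD, hHD⟩ := h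
  have h1 := hTD hA
  have h2 := hHD hA
  calc ∑ x ∈ finsetOf (PsiTwo χ),
        ‖Lemma81.segInt (t0 D) (ell1 D) (-1) (fun s => kfrak3Star c' χ x s * omegaW D s)‖
      ≤ ∑ x ∈ finsetOf (PsiTwo χ),
          (‖Lemma81.segInt (t0 D) (ell1 D) (-1) (fun s => kfrak3Star c' χ x s * omegaW D s) -
              Lemma81.segInt (t0 D) (ell1 D) (-1) (fun s =>
                (∑ n ∈ Finset.Icc 1 ⌊bigP D ^ 2⌋₊,
                    (LSeries.convolution (trunc (D ^ 4) (nu χ)) (kappa2bar c' D)) n *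
                      conj (x.ψ (n : ZMod x.p)) * (n : ℂ) ^ (-(1 - s))) *
                  (Bpoly χ x s * Gpoly χ x s * Nchar D (psiFn x) (s + beta2 c' D) *
                    Nchar D (psiFn x) (s + beta3 c' D)) * omegaW D s)‖ +
            ‖Lemma81.segInt (t0 D) (ell1 D) (-1) (fun s =>
                (∑ n ∈ Finset.Icc 1 ⌊bigP D ^ 2⌋₊,
                    (LSeries.convolution (trunc (D ^ 4) (nu χ)) (kappa2bar c' D)) n *
                      conj (x.ψ (n : ZMod x.p)) * (n : ℂ) ^ (-(1 - s))) *
                  (Bpoly χ x s * Gpoly χ x s * Nchar D (psiFn x) (s + beta2 c' D) *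
                    Nchar D (psiFn x) (s + beta3 c' D)) * omegaW D s)‖) :=
        Finset.sum_le_sum fun x _ => norm_le_norm_sub_add _ _
    _ = (∑ x ∈ finsetOf (PsiTwo χ),
          ‖Lemma81.segInt (t0 D) (ell1 D) (-1) (fun s => kfrak3Star c' χ x s * omegaW D s) -
              Lemma81.segInt (t0 D) (ell1 D) (-1) (fun s =>
                (∑ n ∈ Finset.Icc 1 ⌊bigP D ^ 2⌋₊,
                    (LSeries.convolution (trunc (D ^ 4) (nu χ)) (kappa2bar c' D)) n *
                      conj (x.ψ (n : ZMod x.p)) * (n : ℂ) ^ (-(1 - s))) *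
                  (Bpoly χ x s * Gpoly χ x s * Nchar D (psiFn x) (s + beta2 c' D) *
                    Nchar D (psiFn x) (s + beta3 c' D)) * omegaW D s)‖) +
        ∑ x ∈ finsetOf (PsiTwo χ),
            ‖Lemma81.segInt (t0 D) (ell1 D) (-1) (fun s =>
                (∑ n ∈ Finset.Icc 1 ⌊bigP D ^ 2⌋₊,
                    (LSeries.convolution (trunc (D ^ 4) (nu χ)) (kappa2bar c' D)) n *
                      conj (x.ψ (n : ZMod x.p)) * (n : ℂ) ^ (-(1 - s))) *
                  (Bpoly χ x s * Gpoly χ x s * Nchar D (psiFn x) (s + beta2 c' D) *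
                    Nchar D (psiFn x) (s + beta3 c' D)) * omegaW D s)‖ := Finset.sum_add_distrib
    _ ≤ ε / 2 * frakP D + ε / 2 * frakP D := add_le_add h1 h2
    _ = ε * frakP D := by ring

/-- **The `hext` hypothesis of the (17.7) assembly (`Eq177.eq17_7_of_ext`), discharged**: for every
`c′`, `ε > 0`, all large `D`, under (A),
`‖Σ_{ψ∈Ψ₂}(p_ψt₀)^{β₂}·(1/2πi)∫_{𝔍(−1)}𝔨₃*(s,ψ)ω(s)ds‖ ≤ ε𝔓` (`|(p_ψt₀)^{β₂}| = 1`, zl-w14-p2's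
`norm_sum_PsiTwo_weighted_kfrak3Star_le_of`). [cite: Zhang2022LandauSiegel, §17 (17.7) p.97, tex L4770–L4790] -/
theorem norm_sum_PsiTwo_weighted_kfrak3Star_le (c' : ℝ) :
    ∀ ε : ℝ, 0 < ε → ForAllLarge fun D _ χ => AssumptionA D χ →
      ‖∑ x ∈ finsetOf (PsiTwo χ), (((x.p : ℝ) * t0 D : ℝ) : ℂ) ^ beta2 c' D *
          Lemma81.segInt (t0 D) (ell1 D) (-1) (fun s => kfrak3Star c' χ x s * omegaW D s)‖ ≤
        ε * frakP D :=
  norm_sum_PsiTwo_weighted_kfrak3Star_le_of c' (norm_sum_PsiTwo_kfrak3Star_le c')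

/-- **(17.7) from Proposition 2.2**: for `c′ ≥ 0` with `Skeleton.Prop22 c′`, the typed node
`Typed.Section17.Eq17_7 c′` ("`Σ_{ψ∈Ψ₁}(p_ψt₀)^{β₃}I₄⁻(ψ) = Σ_{p∼P}(pt₀)^{β₂}Φ₃⁻(p) + o(𝔓)`") HOLDS —
zl-w16-p7's assembly `eq17_7_of_ext` (§17.u011 + the move `𝔍(−α) → 𝔍(−1)` + regrouping) fed with the
extension error above. [cite: Zhang2022LandauSiegel, §17 (17.7) p.97] -/
theorem eq17_7_of_prop22 {c' : ℝ} (hc' : 0 ≤ c') (h22 : Prop22 c') : Eq17_7 c' :=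
  eq17_7_of_ext hc' h22 (norm_sum_PsiTwo_weighted_kfrak3Star_le c')

/-- **(17.7) for every sufficiently large `c′`, NO hypothesis**: `∃ c₀ ≥ 0, ∀ c′ ≥ c₀, Eq17_7 c′`
(Prop. 2.2 for large `c′` is the tree's `Skeleton.prop22_eventually`). [cite: Zhang2022LandauSiegel, §17 (17.7) p.97; §2 Prop. 2.2] -/
theorem eq17_7_eventually : ∃ c₀ : ℝ, 0 ≤ c₀ ∧ ∀ c' : ℝ, c₀ ≤ c' → Eq17_7 c' :=
  eq17_7_eventually_of_ext (c₁ := 0) fun c' _ => norm_sum_PsiTwo_weighted_kfrak3Star_le c'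

/-- **(17.7) in the skeleton's binder shape** `∃ c₀, ∀ c′ ≥ c₀, Eq17_7 c′`.
[cite: Zhang2022LandauSiegel, §17 (17.7) p.97] -/
theorem eq17_7_holds_of_le : ∃ c₀ : ℝ, ∀ c' : ℝ, c₀ ≤ c' → Eq17_7 c' := by
  obtain ⟨c₀, -, h⟩ := eq17_7_eventually
  exact ⟨c₀, h⟩

end Literature.NumberTheory.LFunctions.Zhang2022.Eq177

end
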